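import Summits.AnomalousDissipation.AnomalousDissipation.Theorems.ScalarAnomalySteadySourceFormal.Negative.WienModes
import Summits.AnomalousDissipation.AnomalousDissipation.Theorems.ScalarAnomalySteadySourceFormal.Negative.CellTotal

/-!
# Negative knowledge for the crux `ScalarAnomalySteadySourceFormal` (stmt-AnomalousDissipation-0448), X-b:
# Wiener-class stirring — modal integral equation and `C¹` representatives

Certified copy of §12.2 of the cdisprove work file (planar, `d = Fin 2`).  For a weak solution of the
crux's forced class stirred by `u(t) = wienField (C t)` with continuous coefficient paths dominated by a
summable majorant `a` (`‖C t q‖ ≤ a q`, `∑ a < ∞`) and conjugate symmetric: the modal integral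
equation (`wien_ae_mode_eq`, from `Negative.ForcedModes` and `sum_flux_eq_wTransportMode`), the
continuous representatives `wcmodes` (a.e. equal to the modes, all `p` at once), the uniform-in-`p`
slice bound transported to the representatives (`norm_wcmodes_le`), the rebuilt right-hand side
`wcmodeRHS` (continuous: uniform convergence of the transport series, `continuousOn_wTransportMode`),
`hasDerivAt_wcmodes`, and the **band energy identity** `wbandEnergy_sub_eq_integral`.

Supports stmt-AnomalousDissipation-0448 (the Wiener-class no-go, files `Wien*`).
-/

set_option linter.dupNamespace false

noncomputable section

open scoped BigOperators Topology ENNReal NNReal InnerProductSpace ContDiff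
open Filter Set Function MeasureTheory UnitAddTorus Complex

namespace Summit.AnomalousDissipation.AnomalousDissipation.Theorems.ScalarAnomalySteadySourceFormal.Negative

open Literature.Analysis
open Literature.Analysis.FunctionSpaces Literature.Analysis.FunctionSpaces.Torus
open Literature.Analysis.FluidPDE Literature.Analysis.FluidPDE.Torus

/-- The frequency lattice `ℤ²` (local notation). -/
local notation "ℤ²" => Fin 2 → ℤ

section Slices

variable {T κ : ℝ} {u : ℝ → UnitAddTorus (Fin 2) → EuclideanSpace ℝ (Fin 2)} {s : ℝ → UnitAddTorus (Fin 2) → ℝ}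
  {θ₀ : UnitAddTorus (Fin 2) → ℝ} {θ : ℝ → UnitAddTorus (Fin 2) → ℝ}

/-- **Uniform modal bound along a weak solution**: there is `B ≥ 0` with `‖y_p(t)‖ ≤ B` for all `p`,
for a.e. `t ∈ (0,T)` (`‖𝓕θ(t)(p)‖ ≤ ‖θ(t)‖_{L¹} ≤ ‖θ(t)‖_{L²}`). [folklore] -/
theorem forced_ae_norm_modes_le (hw : IsWeakScalarTransportForcedOn T κ u s θ₀ θ) :
    ∃ B : ℝ, 0 ≤ B ∧ ∀ᵐ t ∂(volume.restrict (Ioo 0 T)), ∀ p : ℤ², ‖modes θ t p‖ ≤ B := by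
  obtain ⟨C, hC0, hC⟩ := forced_ae_scalarL2Sq_le hw
  refine ⟨Real.sqrt C, Real.sqrt_nonneg _, ?_⟩
  filter_upwards [hC, forced_ae_memLp_two hw] with t ht hm p
  have h1 : ‖modes θ t p‖ ^ 2 ≤ scalarL2Sq (θ t) := by
    have := sum_sq_norm_mFourierCoeff_le_integral_sq hm {p}
    rwa [Finset.sum_singleton] at this
  calc ‖modes θ t p‖ = Real.sqrt (‖modes θ t p‖ ^ 2) := (Real.sqrt_sq (norm_nonneg _)).symm
    _ ≤ Real.sqrt C := Real.sqrt_le_sqrt (h1.trans ht)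

end Slices

section WienWeak

variable {ν : ℝ} {C : ℝ → ℤ² → EuclideanSpace ℂ (Fin 2)} {a : ℤ² → ℝ}
  {u : ℝ → UnitAddTorus (Fin 2) → EuclideanSpace ℝ (Fin 2)} {h θ₀ : UnitAddTorus (Fin 2) → ℝ}
  {θ : ℝ → UnitAddTorus (Fin 2) → ℝ}

/-- The modal right-hand side under Wiener-class stirring. [folklore] -/
def wModeRHS (ν : ℝ) (C : ℝ → ℤ² → EuclideanSpace ℂ (Fin 2)) (h : UnitAddTorus (Fin 2) → ℝ)
    (Y : ℝ → ℤ² → ℂ) (p : ℤ²) (s : ℝ) : ℂ :=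
  -(((4 * Real.pi ^ 2 * ν * FunctionSpaces.Torus.freqNormSq p : ℝ)) : ℂ) * Y s p -
    wTransportMode (C s) (Y s) p + mFourierCoeff (fun x => (h x : ℂ)) p

/-- Summability of the majorant in norm form. [folklore] -/
theorem summable_norm_of_majorant (hCa : ∀ s q, ‖C s q‖ ≤ a q) (hsa : Summable a) (s : ℝ) :
    Summable fun q => ‖C s q‖ :=
  Summable.of_nonneg_of_le (fun _ => norm_nonneg _) (hCa s) hsa

/-- Termwise bound of the transport series: `‖(p·C_q(s)) Y(p-q)‖ ≤ (∑|pⱼ|) a_q B`. [folklore] -/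
theorem norm_transportTerm_le (hCa : ∀ s q, ‖C s q‖ ≤ a q) {Y : ℤ² → ℂ} {B : ℝ} (hY : ∀ q, ‖Y q‖ ≤ B)
    (p q : ℤ²) (s : ℝ) : ‖zdot p (C s q) * Y (p - q)‖ ≤ (∑ j, |(p j : ℝ)|) * B * a q := by
  have hB : 0 ≤ B := (norm_nonneg _).trans (hY 0)
  rw [norm_mul]
  calc ‖zdot p (C s q)‖ * ‖Y (p - q)‖ ≤ ((∑ j, |(p j : ℝ)|) * ‖C s q‖) * B :=
        mul_le_mul (norm_zdot_le_sum p (C s q)) (hY _) (norm_nonneg _) (by positivity)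
    _ ≤ ((∑ j, |(p j : ℝ)|) * a q) * B := by gcongr; exact hCa s q
    _ = (∑ j, |(p j : ℝ)|) * B * a q := by ring

/-- The transport series as the limit of its partial sums over the boxes `sbox n`. [folklore] -/
theorem tendsto_sum_sbox_transport (hCa : ∀ s q, ‖C s q‖ ≤ a q) (hsa : Summable a) {Y : ℤ² → ℂ} {B : ℝ}
    (hY : ∀ q, ‖Y q‖ ≤ B) (p : ℤ²) (s : ℝ) :
    Tendsto (fun n : ℕ => ∑ q ∈ box (n : ℤ) n, zdot p (C s q) * Y (p - q)) atTop
      (nhds (∑' q, zdot p (C s q) * Y (p - q))) :=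
  ((summable_zdot_mul (summable_norm_of_majorant hCa hsa s) hY p).hasSum).comp tendsto_sbox_atTop

/-- Continuity of `s ↦ p · C_q(s)`. [folklore] -/
theorem continuous_zdot_coeff (hcont : ∀ q, Continuous fun s => C s q) (p q : ℤ²) :
    Continuous fun s => zdot p (C s q) :=
  continuous_finsetSum _ fun j _ => continuous_const.mul ((EuclideanSpace.proj j).continuous.comp (hcont q))

/-- Norm bound of the transport series for bounded modes. [folklore] -/
theorem norm_tsum_transport_le (hCa : ∀ s q, ‖C s q‖ ≤ a q) (hsa : Summable a) {Y : ℤ² → ℂ} {B : ℝ}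
    (hY : ∀ q, ‖Y q‖ ≤ B) (p : ℤ²) (s : ℝ) :
    ‖∑' q, zdot p (C s q) * Y (p - q)‖ ≤ (∑ j, |(p j : ℝ)|) * B * ∑' q, a q := by
  have hsum := summable_zdot_mul (summable_norm_of_majorant hCa hsa s) hY p
  refine (norm_tsum_le_tsum_norm hsum.norm).trans ?_
  rw [← tsum_mul_left]
  exact Summable.tsum_le_tsum (fun q => norm_transportTerm_le hCa hY p q s) hsum.norm (hsa.mul_left _)

variable {T : ℝ}

/-- **Integrability of the transport series along the solution** on `(0,T)`. [folklore] -/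
theorem wien_integrableOn_transport (hw : IsWeakScalarTransportForcedOn T ν u (fun _ => h) θ₀ θ)
    (hCa : ∀ s q, ‖C s q‖ ≤ a q) (hsa : Summable a) (hcont : ∀ q, Continuous fun s => C s q) (p : ℤ²) :
    Integrable (fun s => wTransportMode (C s) (modes θ s) p) (volume.restrict (Ioo 0 T)) := by
  haveI : IsFiniteMeasure ((volume : Measure ℝ).restrict (Ioo 0 T)) := ⟨by
    rw [Measure.restrict_apply_univ]; exact measure_Ioo_lt_top⟩
  obtain ⟨B, hB0, hB⟩ := forced_ae_norm_modes_le hw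
  have hFm : ∀ n : ℕ, AEStronglyMeasurable (fun s => ∑ q ∈ box (n : ℤ) n, zdot p (C s q) * modes θ s (p - q))
      (volume.restrict (Ioo 0 T)) := fun n =>
    Finset.aestronglyMeasurable_fun_sum _ fun q _ =>
      (continuous_zdot_coeff hcont p q).aestronglyMeasurable.mul (forced_integrableOn_mFourierCoeff hw (p - q)).aestronglyMeasurable
  have hlim : ∀ᵐ s ∂(volume.restrict (Ioo 0 T)), Tendsto (fun n : ℕ => ∑ q ∈ box (n : ℤ) n, zdot p (C s q) * modes θ s (p - q))
      atTop (nhds (∑' q, zdot p (C s q) * modes θ s (p - q))) :=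
    hB.mono fun s hs => tendsto_sum_sbox_transport hCa hsa hs p s
  have hmeas : AEStronglyMeasurable (fun s => ∑' q, zdot p (C s q) * modes θ s (p - q)) (volume.restrict (Ioo 0 T)) :=
    aestronglyMeasurable_of_tendsto_ae atTop hFm hlim
  have hbound : ∀ᵐ s ∂(volume.restrict (Ioo 0 T)), ‖∑' q, zdot p (C s q) * modes θ s (p - q)‖ ≤ (∑ j, |(p j : ℝ)|) * B * ∑' q, a q :=
    hB.mono fun s hs => norm_tsum_transport_le hCa hsa hs p s
  have hint : Integrable (fun s => ∑' q, zdot p (C s q) * modes θ s (p - q)) (volume.restrict (Ioo 0 T)) :=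
    (integrable_const ((∑ j, |(p j : ℝ)|) * B * ∑' q, a q)).mono' hmeas hbound
  unfold wTransportMode
  exact hint.const_mul _

/-- The modal right-hand side is integrable on `(0,T)`. [folklore] -/
theorem wien_integrableOn_modeRHS (hw : IsWeakScalarTransportForcedOn T ν u (fun _ => h) θ₀ θ)
    (hCa : ∀ s q, ‖C s q‖ ≤ a q) (hsa : Summable a) (hcont : ∀ q, Continuous fun s => C s q) (p : ℤ²) :
    Integrable (wModeRHS ν C h (modes θ) p) (volume.restrict (Ioo 0 T)) := by
  haveI : IsFiniteMeasure ((volume : Measure ℝ).restrict (Ioo 0 T)) := ⟨by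
    rw [Measure.restrict_apply_univ]; exact measure_Ioo_lt_top⟩
  have h1 : Integrable (fun s => -(((4 * Real.pi ^ 2 * ν * FunctionSpaces.Torus.freqNormSq p : ℝ)) : ℂ) * modes θ s p)
      (volume.restrict (Ioo 0 T)) := (forced_integrableOn_mFourierCoeff hw p).const_mul _
  exact (h1.sub (wien_integrableOn_transport hw hCa hsa hcont p)).add (integrable_const _)

/-- **The modal integral equation under Wiener-class stirring**: for a.e. `t ∈ (0,T)`,
`𝓕θ(t)(p) = 𝓕θ₀(p) + ∫_{(0,t]} (-4π²ν|p|² 𝓕θ(s)(p) - N_p(s) + 𝓕h(p)) ds`. [folklore] -/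
theorem wien_ae_mode_eq (hw : IsWeakScalarTransportForcedOn T ν u (fun _ => h) θ₀ θ)
    (hu : ∀ s, u s = wienField (C s)) (hCa : ∀ s q, ‖C s q‖ ≤ a q) (hsa : Summable a)
    (hsymm : ∀ s q, C s (-q) = EuclideanSpace.conjVec (C s q))
    (hh : Integrable h volume) (hθ₀ : Integrable θ₀ volume) (p : ℤ²) :
    ∀ᵐ t ∂(volume.restrict (Ioo 0 T)),
      modes θ t p = mFourierCoeff (fun x => (θ₀ x : ℂ)) p + ∫ s in Ioc 0 t, wModeRHS ν C h (modes θ) p s := by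
  have hslice : ∀ᵐ s ∂(volume.restrict (Ioo 0 T)),
      (-(((4 * Real.pi ^ 2 * ν * FunctionSpaces.Torus.freqNormSq p : ℝ)) : ℂ) * mFourierCoeff (fun x => (θ s x : ℂ)) p -
        ∑ j, (2 * Real.pi * I * (p j)) * mFourierCoeff (fun x => ((θ s x * u s x j : ℝ) : ℂ)) p +
          mFourierCoeff (fun x => (h x : ℂ)) p) = wModeRHS ν C h (modes θ) p s := by
    filter_upwards [forced_ae_integrable_slice hw] with s hs
    rw [wModeRHS, modes, hu s, sum_flux_eq_wTransportMode hs.1 (summable_norm_of_majorant hCa hsa s) (hsymm s) p]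
    rfl
  filter_upwards [forced_ae_mFourierCoeff_eq hw hh hθ₀ p, ae_restrict_mem measurableSet_Ioo] with t ht htT
  rw [modes, ht]
  congr 1
  refine setIntegral_congr_ae measurableSet_Ioc ?_
  have hsub : ∀ᵐ s ∂(volume : Measure ℝ), s ∈ Ioo 0 T → _ := (ae_restrict_iff' measurableSet_Ioo).1 hslice
  filter_upwards [hsub] with s hs hsI
  exact hs (Ioc_subset_Ioo_right htT.2 hsI)

end WienWeak

section WienRepr

variable {ν : ℝ} {C : ℝ → ℤ² → EuclideanSpace ℂ (Fin 2)} {a : ℤ² → ℝ}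
  {u : ℝ → UnitAddTorus (Fin 2) → EuclideanSpace ℝ (Fin 2)} {h θ₀ : UnitAddTorus (Fin 2) → ℝ}
  {θ : ℝ → UnitAddTorus (Fin 2) → ℝ}

/-- **Continuous representatives of the modes** (Wiener-class stirring). [folklore] -/
def wcmodes (ν : ℝ) (C : ℝ → ℤ² → EuclideanSpace ℂ (Fin 2)) (h θ₀ : UnitAddTorus (Fin 2) → ℝ)
    (θ : ℝ → UnitAddTorus (Fin 2) → ℝ) : ℝ → ℤ² → ℂ :=
  fun t p => mFourierCoeff (fun x => (θ₀ x : ℂ)) p + ∫ s in (0 : ℝ)..t, wModeRHS ν C h (modes θ) p s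

/-- `ỹ_p(0) = 𝓕θ₀(p)`. [folklore] -/
theorem wcmodes_zero (p : ℤ²) : wcmodes ν C h θ₀ θ 0 p = mFourierCoeff (fun x => (θ₀ x : ℂ)) p := by
  simp [wcmodes]

/-- The representatives are versions of the modes, all `p` at once. [folklore] -/
theorem ae_modes_eq_wcmodes (hw : IsWeakScalarTransportForced ν u (fun _ => h) θ₀ θ)
    (hu : ∀ s, u s = wienField (C s)) (hCa : ∀ s q, ‖C s q‖ ≤ a q) (hsa : Summable a)
    (hsymm : ∀ s q, C s (-q) = EuclideanSpace.conjVec (C s q))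
    (hh : Integrable h volume) (hθ₀ : Integrable θ₀ volume) {T : ℝ} (hT : 0 < T) :
    ∀ᵐ t ∂(volume.restrict (Ioo 0 T)), ∀ p, modes θ t p = wcmodes ν C h θ₀ θ t p := by
  refine ae_all_iff.2 fun p => ?_
  filter_upwards [wien_ae_mode_eq (hw T hT) hu hCa hsa hsymm hh hθ₀ p, ae_restrict_mem measurableSet_Ioo] with t ht htm
  rw [ht, wcmodes, intervalIntegral.integral_of_le htm.1.le]

/-- The representatives are continuous on every `[0,T]`. [folklore] -/
theorem continuousOn_wcmodes (hw : IsWeakScalarTransportForced ν u (fun _ => h) θ₀ θ)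
    (hCa : ∀ s q, ‖C s q‖ ≤ a q) (hsa : Summable a) (hcont : ∀ q, Continuous fun s => C s q)
    {T : ℝ} (hT : 0 < T) (p : ℤ²) :
    ContinuousOn (fun t => wcmodes ν C h θ₀ θ t p) (Icc 0 T) := by
  have hint : IntegrableOn (wModeRHS ν C h (modes θ) p) (uIcc 0 T) volume := by
    rw [uIcc_of_le hT.le, integrableOn_Icc_iff_integrableOn_Ioo]
    exact wien_integrableOn_modeRHS (hw T hT) hCa hsa hcont p
  have := intervalIntegral.continuousOn_primitive_interval hint
  rw [uIcc_of_le hT.le] at this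
  exact continuousOn_const.add this

/-- **A continuous function bounded a.e. on an open interval is bounded there.** [folklore] -/
theorem le_of_ae_le_of_continuousOn {g : ℝ → ℝ} {a' b B : ℝ} (hg : ContinuousOn g (Ioo a' b))
    (hae : ∀ᵐ t ∂(volume.restrict (Ioo a' b)), g t ≤ B) : ∀ t ∈ Ioo a' b, g t ≤ B := by
  by_contra hcon
  push Not at hcon
  obtain ⟨t₀, ht₀, hgt⟩ := hcon
  have hopen : IsOpen (Ioo a' b ∩ g ⁻¹' Ioi B) := hg.isOpen_inter_preimage isOpen_Ioo isOpen_Ioi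
  have hne : (Ioo a' b ∩ g ⁻¹' Ioi B).Nonempty := ⟨t₀, ht₀, hgt⟩
  have hpos : 0 < volume (Ioo a' b ∩ g ⁻¹' Ioi B) := hopen.measure_pos volume hne
  have hzero : volume (Ioo a' b ∩ g ⁻¹' Ioi B) = 0 := by
    have h1 := ae_iff.1 hae
    rw [Measure.restrict_apply' measurableSet_Ioo] at h1
    have e : {t | ¬ g t ≤ B} ∩ Ioo a' b = Ioo a' b ∩ g ⁻¹' Ioi B := by
      ext t; simp [not_le, and_comm]
    rwa [e] at h1
  exact absurd hzero hpos.ne'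

/-- The modal right-hand side rebuilt on the representatives. [folklore] -/
def wcmodeRHS (ν : ℝ) (C : ℝ → ℤ² → EuclideanSpace ℂ (Fin 2)) (h θ₀ : UnitAddTorus (Fin 2) → ℝ)
    (θ : ℝ → UnitAddTorus (Fin 2) → ℝ) (p : ℤ²) (s : ℝ) : ℂ :=
  wModeRHS ν C h (wcmodes ν C h θ₀ θ) p s

/-- The rebuilt right-hand side is a version of the original one. [folklore] -/
theorem ae_wModeRHS_eq_wcmodeRHS (hw : IsWeakScalarTransportForced ν u (fun _ => h) θ₀ θ)
    (hu : ∀ s, u s = wienField (C s)) (hCa : ∀ s q, ‖C s q‖ ≤ a q) (hsa : Summable a)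
    (hsymm : ∀ s q, C s (-q) = EuclideanSpace.conjVec (C s q))
    (hh : Integrable h volume) (hθ₀ : Integrable θ₀ volume) {T : ℝ} (hT : 0 < T) (p : ℤ²) :
    ∀ᵐ s ∂(volume.restrict (Ioo 0 T)), wModeRHS ν C h (modes θ) p s = wcmodeRHS ν C h θ₀ θ p s := by
  filter_upwards [ae_modes_eq_wcmodes hw hu hCa hsa hsymm hh hθ₀ hT] with s hs
  have e : modes θ s = wcmodes ν C h θ₀ θ s := funext hs
  simp only [wcmodeRHS, wModeRHS, e]

/-- Integral equation with the rebuilt integrand: `ỹ_p(t) = 𝓕θ₀(p) + ∫₀ᵗ wcmodeRHS_p` on `[0,T]`. [folklore] -/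
theorem wcmodes_eq_integral (hw : IsWeakScalarTransportForced ν u (fun _ => h) θ₀ θ)
    (hu : ∀ s, u s = wienField (C s)) (hCa : ∀ s q, ‖C s q‖ ≤ a q) (hsa : Summable a)
    (hsymm : ∀ s q, C s (-q) = EuclideanSpace.conjVec (C s q))
    (hh : Integrable h volume) (hθ₀ : Integrable θ₀ volume) {T : ℝ} (hT : 0 < T) {t : ℝ} (ht : t ∈ Icc 0 T) (p : ℤ²) :
    wcmodes ν C h θ₀ θ t p = mFourierCoeff (fun x => (θ₀ x : ℂ)) p + ∫ s in (0 : ℝ)..t, wcmodeRHS ν C h θ₀ θ p s := by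
  have hT1 : 0 < T + 1 := by linarith
  have hae := ae_wModeRHS_eq_wcmodeRHS hw hu hCa hsa hsymm hh hθ₀ hT1 p
  rw [wcmodes]
  congr 1
  refine intervalIntegral.integral_congr_ae ?_
  have hsub : ∀ᵐ s ∂(volume : Measure ℝ), s ∈ Ioo 0 (T + 1) → _ := (ae_restrict_iff' measurableSet_Ioo).1 hae
  filter_upwards [hsub] with s hs hsI
  rw [uIoc_of_le ht.1] at hsI
  exact hs ⟨hsI.1, lt_of_le_of_lt hsI.2 (by linarith [ht.2])⟩

/-- **Uniform bound of the representatives on `(0,T)`**: `‖ỹ_r(t)‖ ≤ B` for all `r` and all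
`t ∈ (0,T)` (a.e. slice bound + continuity). [folklore] -/
theorem norm_wcmodes_le (hw : IsWeakScalarTransportForced ν u (fun _ => h) θ₀ θ)
    (hu : ∀ s, u s = wienField (C s)) (hCa : ∀ s q, ‖C s q‖ ≤ a q) (hsa : Summable a)
    (hsymm : ∀ s q, C s (-q) = EuclideanSpace.conjVec (C s q)) (hcont : ∀ q, Continuous fun s => C s q)
    (hh : Integrable h volume) (hθ₀ : Integrable θ₀ volume) {T : ℝ} (hT : 0 < T) :
    ∃ B : ℝ, 0 ≤ B ∧ ∀ t ∈ Ioo 0 T, ∀ r : ℤ², ‖wcmodes ν C h θ₀ θ t r‖ ≤ B := by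
  obtain ⟨B, hB0, hB⟩ := forced_ae_norm_modes_le (hw T hT)
  refine ⟨B, hB0, fun t ht r => ?_⟩
  have hae : ∀ᵐ s ∂(volume.restrict (Ioo 0 T)), ‖wcmodes ν C h θ₀ θ s r‖ ≤ B := by
    filter_upwards [hB, ae_modes_eq_wcmodes hw hu hCa hsa hsymm hh hθ₀ hT] with s hs he
    rw [← he r]; exact hs r
  exact le_of_ae_le_of_continuousOn (((continuousOn_wcmodes hw hCa hsa hcont hT r).mono Ioo_subset_Icc_self).norm) hae t ht

/-- Continuity of the transport series along the representatives on `(0,T)` (uniform convergence). [folklore] -/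
theorem continuousOn_wTransportMode_wcmodes (hw : IsWeakScalarTransportForced ν u (fun _ => h) θ₀ θ)
    (hu : ∀ s, u s = wienField (C s)) (hCa : ∀ s q, ‖C s q‖ ≤ a q) (hsa : Summable a)
    (hsymm : ∀ s q, C s (-q) = EuclideanSpace.conjVec (C s q)) (hcont : ∀ q, Continuous fun s => C s q)
    (hh : Integrable h volume) (hθ₀ : Integrable θ₀ volume) {T : ℝ} (hT : 0 < T) (p : ℤ²) :
    ContinuousOn (fun s => wTransportMode (C s) (wcmodes ν C h θ₀ θ s) p) (Ioo 0 T) := by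
  obtain ⟨B, hB0, hB⟩ := norm_wcmodes_le hw hu hCa hsa hsymm hcont hh hθ₀ hT
  unfold wTransportMode
  refine continuousOn_const.mul ?_
  refine continuousOn_tsum (fun q => ?_) (hsa.mul_left ((∑ j, |(p j : ℝ)|) * B)) fun q s hs => ?_
  · exact (continuous_zdot_coeff hcont p q).continuousOn.mul
      ((continuousOn_wcmodes hw hCa hsa hcont hT (p - q)).mono Ioo_subset_Icc_self)
  · exact norm_transportTerm_le hCa (hB s hs) p q s

/-- The rebuilt right-hand side is continuous on `(0,T)`. [folklore] -/
theorem continuousOn_wcmodeRHS (hw : IsWeakScalarTransportForced ν u (fun _ => h) θ₀ θ)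
    (hu : ∀ s, u s = wienField (C s)) (hCa : ∀ s q, ‖C s q‖ ≤ a q) (hsa : Summable a)
    (hsymm : ∀ s q, C s (-q) = EuclideanSpace.conjVec (C s q)) (hcont : ∀ q, Continuous fun s => C s q)
    (hh : Integrable h volume) (hθ₀ : Integrable θ₀ volume) {T : ℝ} (hT : 0 < T) (p : ℤ²) :
    ContinuousOn (wcmodeRHS ν C h θ₀ θ p) (Ioo 0 T) := by
  unfold wcmodeRHS wModeRHS
  refine ((continuousOn_const.mul ((continuousOn_wcmodes hw hCa hsa hcont hT p).mono Ioo_subset_Icc_self)).sub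
    (continuousOn_wTransportMode_wcmodes hw hu hCa hsa hsymm hcont hh hθ₀ hT p)).add continuousOn_const

/-- The rebuilt right-hand side is integrable on `(0,T)` (a version of the original one). [folklore] -/
theorem integrableOn_wcmodeRHS (hw : IsWeakScalarTransportForced ν u (fun _ => h) θ₀ θ)
    (hu : ∀ s, u s = wienField (C s)) (hCa : ∀ s q, ‖C s q‖ ≤ a q) (hsa : Summable a)
    (hsymm : ∀ s q, C s (-q) = EuclideanSpace.conjVec (C s q)) (hcont : ∀ q, Continuous fun s => C s q)
    (hh : Integrable h volume) (hθ₀ : Integrable θ₀ volume) {T : ℝ} (hT : 0 < T) (p : ℤ²) :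
    IntegrableOn (wcmodeRHS ν C h θ₀ θ p) (Ioo 0 T) volume :=
  (wien_integrableOn_modeRHS (hw T hT) hCa hsa hcont p).congr (ae_wModeRHS_eq_wcmodeRHS hw hu hCa hsa hsymm hh hθ₀ hT p)

/-- **The representatives are `C¹` on `(0,T)`**: `ỹ_p' = wcmodeRHS_p`. [folklore] -/
theorem hasDerivAt_wcmodes (hw : IsWeakScalarTransportForced ν u (fun _ => h) θ₀ θ)
    (hu : ∀ s, u s = wienField (C s)) (hCa : ∀ s q, ‖C s q‖ ≤ a q) (hsa : Summable a)
    (hsymm : ∀ s q, C s (-q) = EuclideanSpace.conjVec (C s q)) (hcont : ∀ q, Continuous fun s => C s q)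
    (hh : Integrable h volume) (hθ₀ : Integrable θ₀ volume)
    {T : ℝ} (hT : 0 < T) {t : ℝ} (ht : t ∈ Ioo 0 T) (p : ℤ²) :
    HasDerivAt (fun s => wcmodes ν C h θ₀ θ s p) (wcmodeRHS ν C h θ₀ θ p t) t := by
  have hT1 : 0 < T + 1 := by linarith
  have ht1 : t ∈ Ioo 0 (T + 1) := ⟨ht.1, by linarith [ht.2]⟩
  have hG := continuousOn_wcmodeRHS hw hu hCa hsa hsymm hcont hh hθ₀ hT1 p
  have hI := integrableOn_wcmodeRHS hw hu hCa hsa hsymm hcont hh hθ₀ hT1 p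
  have hΦ : HasDerivAt (fun s => mFourierCoeff (fun x => (θ₀ x : ℂ)) p +
      ∫ r in (0 : ℝ)..s, wcmodeRHS ν C h θ₀ θ p r) (wcmodeRHS ν C h θ₀ θ p t) t := by
    refine (intervalIntegral.integral_hasDerivAt_right ?_ ?_ ?_).const_add _
    · rw [intervalIntegrable_iff_integrableOn_Ioo_of_le ht.1.le]
      exact hI.mono_set (Ioo_subset_Ioo_right (by linarith [ht.2]))
    · exact hG.stronglyMeasurableAtFilter isOpen_Ioo _ ht1
    · exact hG.continuousAt (Ioo_mem_nhds ht1.1 ht1.2)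
  refine hΦ.congr_of_eventuallyEq ?_
  filter_upwards [Icc_mem_nhds ht.1 ht.2] with s hs
  exact wcmodes_eq_integral hw hu hCa hsa hsymm hh hθ₀ hT hs p

/-- The band energy of the representatives is differentiable on `(0,T)`. [folklore] -/
theorem hasDerivAt_wbandEnergy (hw : IsWeakScalarTransportForced ν u (fun _ => h) θ₀ θ)
    (hu : ∀ s, u s = wienField (C s)) (hCa : ∀ s q, ‖C s q‖ ≤ a q) (hsa : Summable a)
    (hsymm : ∀ s q, C s (-q) = EuclideanSpace.conjVec (C s q)) (hcont : ∀ q, Continuous fun s => C s q)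
    (hh : Integrable h volume) (hθ₀ : Integrable θ₀ volume)
    {T : ℝ} (hT : 0 < T) {t : ℝ} (ht : t ∈ Ioo 0 T) (𝔅 : Finset ℤ²) :
    HasDerivAt (fun s => bandEnergy 𝔅 (wcmodes ν C h θ₀ θ s))
      (∑ p ∈ 𝔅, 2 * ⟪wcmodes ν C h θ₀ θ t p, wcmodeRHS ν C h θ₀ θ p t⟫_ℝ) t := by
  unfold bandEnergy
  exact HasDerivAt.fun_sum fun p _ => (hasDerivAt_wcmodes hw hu hCa hsa hsymm hcont hh hθ₀ hT ht p).norm_sq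

/-- The derivative of the band energy is integrable on `(0,T)` (bounded modes times integrable RHS). [folklore] -/
theorem integrableOn_wbandEnergy_deriv (hw : IsWeakScalarTransportForced ν u (fun _ => h) θ₀ θ)
    (hu : ∀ s, u s = wienField (C s)) (hCa : ∀ s q, ‖C s q‖ ≤ a q) (hsa : Summable a)
    (hsymm : ∀ s q, C s (-q) = EuclideanSpace.conjVec (C s q)) (hcont : ∀ q, Continuous fun s => C s q)
    (hh : Integrable h volume) (hθ₀ : Integrable θ₀ volume) {T : ℝ} (hT : 0 < T) (𝔅 : Finset ℤ²) :
    IntegrableOn (fun t => ∑ p ∈ 𝔅, 2 * ⟪wcmodes ν C h θ₀ θ t p, wcmodeRHS ν C h θ₀ θ p t⟫_ℝ) (Ioo 0 T) volume := by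
  obtain ⟨B, hB0, hB⟩ := norm_wcmodes_le hw hu hCa hsa hsymm hcont hh hθ₀ hT
  refine integrable_finsetSum _ fun p _ => Integrable.const_mul ?_ _
  have hprod : IntegrableOn (fun t => (starRingEnd ℂ) (wcmodes ν C h θ₀ θ t p) * wcmodeRHS ν C h θ₀ θ p t) (Ioo 0 T) volume := by
    refine (integrableOn_wcmodeRHS hw hu hCa hsa hsymm hcont hh hθ₀ hT p).bdd_mul (c := B) ?_ ?_
    · exact (Complex.continuous_conj.comp_aestronglyMeasurable
        (((continuousOn_wcmodes hw hCa hsa hcont hT p).mono Ioo_subset_Icc_self).aestronglyMeasurable measurableSet_Ioo))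
    · refine (ae_restrict_iff' measurableSet_Ioo).2 (Eventually.of_forall fun t ht => ?_)
      rw [Complex.norm_conj]; exact hB t ht p
  have e : (fun t => ⟪wcmodes ν C h θ₀ θ t p, wcmodeRHS ν C h θ₀ θ p t⟫_ℝ) =
      fun t => ((starRingEnd ℂ) (wcmodes ν C h θ₀ θ t p) * wcmodeRHS ν C h θ₀ θ p t).re := by
    funext t; rw [Complex.inner, mul_comm]
  rw [show (fun t => ⟪wcmodes ν C h θ₀ θ t p, wcmodeRHS ν C h θ₀ θ p t⟫_ℝ) = _ from e]
  exact hprod.re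

/-- **Band energy identity** (Wiener-class stirring) on `[0,T]`. [folklore] -/
theorem wbandEnergy_sub_eq_integral (hw : IsWeakScalarTransportForced ν u (fun _ => h) θ₀ θ)
    (hu : ∀ s, u s = wienField (C s)) (hCa : ∀ s q, ‖C s q‖ ≤ a q) (hsa : Summable a)
    (hsymm : ∀ s q, C s (-q) = EuclideanSpace.conjVec (C s q)) (hcont : ∀ q, Continuous fun s => C s q)
    (hh : Integrable h volume) (hθ₀ : Integrable θ₀ volume) {T : ℝ} (hT : 0 < T) (𝔅 : Finset ℤ²) :
    bandEnergy 𝔅 (wcmodes ν C h θ₀ θ T) - bandEnergy 𝔅 (wcmodes ν C h θ₀ θ 0) =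
      ∫ t in (0 : ℝ)..T, ∑ p ∈ 𝔅, 2 * ⟪wcmodes ν C h θ₀ θ t p, wcmodeRHS ν C h θ₀ θ p t⟫_ℝ := by
  have hY : ∀ q, ContinuousOn (fun s => wcmodes ν C h θ₀ θ s q) (Icc 0 T) := fun q => continuousOn_wcmodes hw hCa hsa hcont hT q
  symm
  refine intervalIntegral.integral_eq_sub_of_hasDerivAt_of_le hT.le ?_
    (fun t ht => hasDerivAt_wbandEnergy hw hu hCa hsa hsymm hcont hh hθ₀ hT ht 𝔅) ?_
  · unfold bandEnergy
    exact continuousOn_finsetSum _ fun p _ => ((hY p).norm).pow 2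
  · rw [intervalIntegrable_iff_integrableOn_Ioo_of_le hT.le]
    exact integrableOn_wbandEnergy_deriv hw hu hCa hsa hsymm hcont hh hθ₀ hT 𝔅

end WienRepr

end Summit.AnomalousDissipation.AnomalousDissipation.Theorems.ScalarAnomalySteadySourceFormal.Negative
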